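import Mathlib.Algebra.BigOperators.Fin
import Mathlib.Algebra.Order.BigOperators.Group.Finset
import Mathlib.Data.Nat.Bitwise
import Mathlib.Tactic.Zify
import Mathlib.Tactic.LinearCombination
import Mathlib.Tactic.Ring
import Mathlib.Tactic.NormNum
import Literature.Computability.Complexity.CircuitComposition
import Literature.Computability.AlgebraicComplexity.BooleanGadgets
import HarnessLib

/-!
# Ripple-carry addition and schoolbook multiplication by polynomial-size `B₂`-circuits

Two textbook straight-line programs in the multi-output gate-list framework of
`Literature.Computability.Complexity.CircuitComposition` (`CktSize B f s`: the Boolean map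
`f : (ι → Bool) → (κ → Bool)` has a circuit over the basis `B` with at most `s` gates):

* `ArithCkt.cktSize_addBits`: the `m + 1` bits of the sum of two `m`-bit numbers are computed by
  a `B₂`-circuit with `≤ 73 m + 1` gates (ripple-carry adder, "the school method for addition":
  one full adder per position; Vollmer 1999, §1.1, p. 8);
* `ArithCkt.cktSize_mulBits`: the `2m` bits of the product of two `m`-bit numbers are computed by
  a `B₂`-circuit with `≤ m (148 m + 1) + 1` gates ("the school method for multiplication":
  `a · b = ∑_i c_i` with `c_i = a · 2^i` if `b_i = 1`, else `0`; the `c_i` are added one at a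
  time with width-`2m` adders; Vollmer 1999, §1.3.2, cf. Thm. 1.23).

Numbers are little-endian bit vectors `Fin m → Bool` read through Batteries' `Nat.ofBits` (and its
sum form `BoolGadgets.ofBits_eq_sum` from `BooleanGadgets.lean`); the
computed maps are `bitsOf F w x l = testBit (F x) l` for the arithmetic function `F`
(`addVal`, `mulVal`), so that correctness is literally "output wire `l` carries bit `l` of
`A + B` (resp. `A · B`)". Only the existence of polynomial-size circuits matters downstream
(Valiant's criterion for a `P`-definable family, `TavenasVnWitness.lean`); the constants are
whatever the generic constructions give (a full adder is taken from the universal bound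
`univBound 3 = 36` of `cktSize_univ_fin` rather than hand-optimised to `5`).

## References

* H. Vollmer, *Introduction to Circuit Complexity*, Springer 1999, §1.1 (p. 8: the school
  method for addition, carries `c_i`, sum bits `s_i = a_i ⊕ b_i ⊕ c_i`), §1.3.2 (the school
  method for multiplication, Thm. 1.23).
* I. Wegener, *The Complexity of Boolean Functions*, Wiley–Teubner 1987, Ch. 3, §3.1–3.2
  (the same constructions with exact gate counts).
-/

namespace Literature.Computability.Complexity

open Finset

namespace ArithCkt

open Literature.Computability.AlgebraicComplexity.BoolGadgets (ofBits_eq_sum)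

variable {ι : Type*}

/-! ### Bit vectors of numbers -/

/-- The width-`w` little-endian bit vector of a number-valued function of the inputs:
`bitsOf F w x l = testBit (F x) l`. [folklore] -/
def bitsOf (F : (ι → Bool) → ℕ) (w : ℕ) (x : ι → Bool) (l : Fin w) : Bool := (F x).testBit l

/-- Reading back: `ofBits (bitsOf F w x) = F x mod 2^w`. [folklore] -/
theorem ofBits_bitsOf (F : (ι → Bool) → ℕ) (w : ℕ) (x : ι → Bool) :
    Nat.ofBits (bitsOf F w x) = F x % 2 ^ w :=
  Nat.ofBits_testBit _ _

/-- Bit vectors with the same value are equal. [folklore] -/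
theorem funext_of_ofBits_eq {w : ℕ} {f g : Fin w → Bool} (h : Nat.ofBits f = Nat.ofBits g) : f = g := by
  funext l
  have := congrArg (fun x => Nat.testBit x l) h
  simpa [Nat.testBit_ofBits_lt _ _ l.isLt] using this

/-! ### The full adder -/

/-- Sum bit of a full adder: `a ⊕ b ⊕ c`. [cite: Vollmer1999, §1.1] -/
def faSum (a b c : Bool) : Bool := (a ^^ b) ^^ c

/-- Carry bit of a full adder: majority of `a, b, c`. [cite: Vollmer1999, §1.1] -/
def faCarry (a b c : Bool) : Bool := (a && b) || (c && (a ^^ b))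

/-- The full adder adds: `s + 2 c' = a + b + c`. [cite: Vollmer1999, §1.1] -/
theorem fa_spec (a b c : Bool) :
    (faSum a b c).toNat + 2 * (faCarry a b c).toNat = a.toNat + b.toNat + c.toNat := by
  cases a <;> cases b <;> cases c <;> rfl

/-- A full-adder sum bit on three given wires costs `≤ 36` gates (universal bound for three
variables). [cite: Vollmer1999, §1.1] -/
theorem cktSize_faSum (wa wb wc : ι) :
    CktSize B2 (fun (x : ι → Bool) (_ : Unit) => faSum (x wa) (x wb) (x wc)) 36 :=
  (((cktSize_univ_fin 3 fun y _ => faSum (y 0) (y 1) (y 2)).rewire ![wa, wb, wc]).of_le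
    (by simp [univBound])).congr fun x _ => by simp

/-- A full-adder carry bit on three given wires costs `≤ 36` gates. [cite: Vollmer1999, §1.1] -/
theorem cktSize_faCarry (wa wb wc : ι) :
    CktSize B2 (fun (x : ι → Bool) (_ : Unit) => faCarry (x wa) (x wb) (x wc)) 36 :=
  (((cktSize_univ_fin 3 fun y _ => faCarry (y 0) (y 1) (y 2)).rewire ![wa, wb, wc]).of_le
    (by simp [univBound])).congr fun x _ => by simp

/-! ### The ripple-carry adder -/

/-- The sum of the two `m`-bit blocks of the input. [cite: Vollmer1999, §1.1] -/
def addVal (m : ℕ) (x : Fin m ⊕ Fin m → Bool) : ℕ :=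
  Nat.ofBits (fun i => x (Sum.inl i)) + Nat.ofBits (fun i => x (Sum.inr i))

/-- The `m + 1` output bits of the adder. [cite: Vollmer1999, §1.1] -/
def addBits (m : ℕ) : (Fin m ⊕ Fin m → Bool) → Fin (m + 1) → Bool := bitsOf (addVal m) (m + 1)

/-- The sum of two `m`-bit numbers has `m + 1` bits. [folklore] -/
theorem addVal_lt (m : ℕ) (x : Fin m ⊕ Fin m → Bool) : addVal m x < 2 ^ (m + 1) := by
  have h1 := Nat.ofBits_lt_two_pow (fun i => x (Sum.inl i))
  have h2 := Nat.ofBits_lt_two_pow (fun i => x (Sum.inr i))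
  rw [addVal, pow_succ]; omega

/-- The adder's output bits spell the sum. [cite: Vollmer1999, §1.1] -/
theorem ofBits_addBits (m : ℕ) (x : Fin m ⊕ Fin m → Bool) : Nat.ofBits (addBits m x) = addVal m x := by
  rw [addBits, ofBits_bitsOf, Nat.mod_eq_of_lt (addVal_lt m x)]

/-- Gate budget of the `m`-bit ripple-carry adder. [cite: Vollmer1999, §1.1] -/
def addSize (m : ℕ) : ℕ := 73 * m + 1

/-- Wire type after the recursive call: the `m + 1` bits of the low sum, then the inputs. [folklore] -/
abbrev AddWires (m : ℕ) : Type := Fin (m + 1) ⊕ (Fin (m + 1) ⊕ Fin (m + 1))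

/-- The last stage of the `(m+1)`-bit adder: keep the `m` low bits of the low sum, and full-add
its carry (bit `m`) with the two top input bits. [cite: Vollmer1999, §1.1] -/
def stepFn (m : ℕ) (y : AddWires m → Bool) : Fin m ⊕ (Unit ⊕ Unit) → Bool :=
  Sum.elim (fun l => y (Sum.inl l.castSucc))
    (Sum.elim
      (fun _ => faSum (y (Sum.inl (Fin.last m))) (y (Sum.inr (Sum.inl (Fin.last m)))) (y (Sum.inr (Sum.inr (Fin.last m)))))
      (fun _ => faCarry (y (Sum.inl (Fin.last m))) (y (Sum.inr (Sum.inl (Fin.last m)))) (y (Sum.inr (Sum.inr (Fin.last m))))))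

/-- The last stage costs `72` gates (two full-adder outputs; the low bits are wires). [cite: Vollmer1999, §1.1] -/
theorem cktSize_stepFn (m : ℕ) : CktSize B2 (stepFn m) 72 := by
  have h := (CktSize.proj B2 (fun l : Fin m => (Sum.inl l.castSucc : AddWires m))).pair
    ((cktSize_faSum (ι := AddWires m) (Sum.inl (Fin.last m)) (Sum.inr (Sum.inl (Fin.last m))) (Sum.inr (Sum.inr (Fin.last m)))).pair
      (cktSize_faCarry (ι := AddWires m) (Sum.inl (Fin.last m)) (Sum.inr (Sum.inl (Fin.last m))) (Sum.inr (Sum.inr (Fin.last m)))))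
  exact h.congr fun y w => by rcases w with l | u | u <;> rfl

/-- Routing the `m + 2` output positions to the wires of the last stage. [folklore] -/
def stepRoute (m : ℕ) (l : Fin (m + 2)) : Fin m ⊕ (Unit ⊕ Unit) :=
  if h : l.val < m then Sum.inl ⟨l.val, h⟩ else if l.val = m then Sum.inr (Sum.inl ()) else Sum.inr (Sum.inr ())

/-- Low positions are routed to the low sum bits. [folklore] -/
theorem stepRoute_castSucc_castSucc (m : ℕ) (i : Fin m) : stepRoute m i.castSucc.castSucc = Sum.inl i := by
  unfold stepRoute
  rw [dif_pos (by simp)]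
  simp

/-- Position `m` is the full-adder sum. [folklore] -/
theorem stepRoute_last_castSucc (m : ℕ) : stepRoute m (Fin.last m).castSucc = Sum.inr (Sum.inl ()) := by
  unfold stepRoute
  rw [dif_neg (by simp), if_pos (by simp)]

/-- Position `m + 1` is the full-adder carry. [folklore] -/
theorem stepRoute_last (m : ℕ) : stepRoute m (Fin.last (m + 1)) = Sum.inr (Sum.inr ()) := by
  unfold stepRoute
  rw [dif_neg (by simp), if_neg (by simp)]

/-- The embedding of the low `m`-bit blocks into the `(m+1)`-bit blocks. [folklore] -/
def lowEmb (m : ℕ) : Fin m ⊕ Fin m → Fin (m + 1) ⊕ Fin (m + 1) := Sum.map Fin.castSucc Fin.castSucc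

/-- A carry read off bit `m` of a number `< 2^{m+1}` is the quotient by `2^m`. [folklore] -/
theorem toNat_testBit_of_lt {S m : ℕ} (h : S < 2 ^ (m + 1)) : (S.testBit m).toNat = S / 2 ^ m := by
  rw [Nat.toNat_testBit]
  have : S / 2 ^ m < 2 := Nat.div_lt_of_lt_mul (by rw [← pow_succ]; exact h)
  exact Nat.mod_eq_of_lt this

/-- **Induction step of the ripple-carry adder**: from an `m`-bit adder of size `addSize m` to an
`(m+1)`-bit adder of size `addSize (m+1)`. [cite: Vollmer1999, §1.1] -/
theorem cktSize_addBits_succ (m : ℕ) (ih : CktSize B2 (addBits m) (addSize m)) :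
    CktSize B2 (addBits (m + 1)) (addSize (m + 1)) := by
  have h1 : CktSize B2 (fun x : Fin (m + 1) ⊕ Fin (m + 1) → Bool =>
      Sum.elim (addBits m (fun i => x (lowEmb m i))) x) (addSize m + 0) :=
    (ih.rewire (lowEmb m)).pair (CktSize.id B2)
  have h2 := (h1.comp (cktSize_stepFn m)).outMap (stepRoute m)
  refine (h2.of_le (by simp only [addSize]; omega)).congr fun x => ?_
  -- pointwise equality of the output bit vectors, through their values
  suffices key : (fun l => stepFn m (Sum.elim (addBits m (fun i => x (lowEmb m i))) x) (stepRoute m l)) =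
      addBits (m + 1) x from fun l => congrFun key l
  apply funext_of_ofBits_eq
  -- names
  set S : ℕ := addVal m (fun i => x (lowEmb m i)) with hS
  set a : Bool := x (Sum.inl (Fin.last m)) with ha
  set b : Bool := x (Sum.inr (Fin.last m)) with hb
  set c : Bool := S.testBit m with hc
  have hSlt : S < 2 ^ (m + 1) := addVal_lt m _
  -- the value of the step's output
  have hL : Nat.ofBits (fun l => stepFn m (Sum.elim (addBits m (fun i => x (lowEmb m i))) x) (stepRoute m l)) =
      S % 2 ^ m + (faSum c a b).toNat * 2 ^ m + (faCarry c a b).toNat * 2 ^ (m + 1) := by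
    rw [ofBits_eq_sum, Fin.sum_univ_castSucc, Fin.sum_univ_castSucc]
    simp only [stepRoute_castSucc_castSucc, stepRoute_last_castSucc, stepRoute_last, stepFn, Sum.elim_inl,
      Sum.elim_inr, Fin.val_last, Fin.val_castSucc]
    congr 1
    -- the low bits of `S`
    have hlow : ∑ i : Fin m, (addBits m (fun i => x (lowEmb m i)) i.castSucc).toNat * 2 ^ (i : ℕ) = S % 2 ^ m := by
      rw [← Nat.ofBits_testBit S m, ofBits_eq_sum]
      rfl
    rw [hlow]
    rfl
  -- the value of the specification
  have hR : Nat.ofBits (addBits (m + 1) x) = (Nat.ofBits (fun i : Fin m => x (Sum.inl i.castSucc)) + a.toNat * 2 ^ m) +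
      (Nat.ofBits (fun i : Fin m => x (Sum.inr i.castSucc)) + b.toNat * 2 ^ m) := by
    rw [ofBits_addBits, addVal, ofBits_eq_sum, ofBits_eq_sum, ofBits_eq_sum, ofBits_eq_sum,
      Fin.sum_univ_castSucc, Fin.sum_univ_castSucc]
    simp only [Fin.val_castSucc, Fin.val_last]
    rfl
  have hSdef : S = Nat.ofBits (fun i : Fin m => x (Sum.inl i.castSucc)) + Nat.ofBits (fun i : Fin m => x (Sum.inr i.castSucc)) := rfl
  rw [hL, hR]
  -- arithmetic
  have hfa := fa_spec c a b
  have hcS : c.toNat = S / 2 ^ m := toNat_testBit_of_lt hSlt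
  have hdiv : S % 2 ^ m + 2 ^ m * (S / 2 ^ m) = S := Nat.mod_add_div S (2 ^ m)
  rw [pow_succ]
  zify at hfa hcS hdiv hSdef ⊢
  linear_combination (2 ^ m : ℤ) * hfa + hdiv + (2 ^ m : ℤ) * hcS + hSdef

/-- **The ripple-carry adder** (Vollmer 1999, §1.1, p. 8): the `m + 1` bits of the sum of two
`m`-bit numbers by a `B₂`-circuit with at most `73 m + 1` gates. [cite: Vollmer1999, §1.1] -/
theorem cktSize_addBits : ∀ m : ℕ, CktSize B2 (addBits m) (addSize m)
  | 0 => ((cktSize_const (Fin 0 ⊕ Fin 0) false).outMap (fun _ : Fin 1 => ())).congr fun x l => by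
      simp [addBits, bitsOf, addVal]
  | m + 1 => cktSize_addBits_succ m (cktSize_addBits m)

/-! ### The schoolbook multiplier -/

/-- The product of the two `m`-bit blocks of the input. [cite: Vollmer1999, §1.3.2] -/
def mulVal (m : ℕ) (x : Fin m ⊕ Fin m → Bool) : ℕ :=
  Nat.ofBits (fun i => x (Sum.inl i)) * Nat.ofBits (fun i => x (Sum.inr i))

/-- The `2m` output bits of the multiplier. [cite: Vollmer1999, §1.3.2] -/
def mulBits (m : ℕ) : (Fin m ⊕ Fin m → Bool) → Fin (m + m) → Bool := bitsOf (mulVal m) (m + m)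

/-- The product of two `m`-bit numbers has `2m` bits. [folklore] -/
theorem mulVal_lt (m : ℕ) (x : Fin m ⊕ Fin m → Bool) : mulVal m x < 2 ^ (m + m) := by
  rw [mulVal, pow_add]
  exact Nat.mul_lt_mul'' (Nat.ofBits_lt_two_pow _) (Nat.ofBits_lt_two_pow _)

/-- The multiplier's output bits spell the product. [cite: Vollmer1999, §1.3.2] -/
theorem ofBits_mulBits (m : ℕ) (x : Fin m ⊕ Fin m → Bool) : Nat.ofBits (mulBits m x) = mulVal m x := by
  rw [mulBits, ofBits_bitsOf, Nat.mod_eq_of_lt (mulVal_lt m x)]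

/-- The accumulator after `i` shift-and-add rounds: `(A mod 2^i) · B`. [cite: Vollmer1999, §1.3.2] -/
def accVal (m i : ℕ) (x : Fin m ⊕ Fin m → Bool) : ℕ :=
  (Nat.ofBits (fun j => x (Sum.inl j)) % 2 ^ i) * Nat.ofBits (fun j => x (Sum.inr j))

/-- The accumulator bits. [cite: Vollmer1999, §1.3.2] -/
def accBits (m i : ℕ) : (Fin m ⊕ Fin m → Bool) → Fin (m + m) → Bool := bitsOf (accVal m i) (m + m)

/-- The accumulator never overflows `2m` bits. [folklore] -/
theorem accVal_lt (m i : ℕ) (x : Fin m ⊕ Fin m → Bool) : accVal m i x < 2 ^ (m + m) := by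
  refine lt_of_le_of_lt ?_ (mulVal_lt m x)
  exact Nat.mul_le_mul_right _ (Nat.mod_le _ _)

/-- The accumulator bits spell the accumulator. [folklore] -/
theorem ofBits_accBits (m i : ℕ) (x : Fin m ⊕ Fin m → Bool) : Nat.ofBits (accBits m i x) = accVal m i x := by
  rw [accBits, ofBits_bitsOf, Nat.mod_eq_of_lt (accVal_lt m i x)]

/-- Wire type during the multiplication: the inputs, then the current accumulator. [folklore] -/
abbrev MulWires (m : ℕ) : Type := (Fin m ⊕ Fin m) ⊕ Fin (m + m)

/-- Round `i`'s addend `[a_i] · B · 2^i`, bit by bit: bit `l` is `a_i ∧ b_{l-i}` for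
`i ≤ l < i + m`, else `0`. [cite: Vollmer1999, §1.3.2] -/
def maskFn (m i : ℕ) (y : MulWires m → Bool) (l : Fin (m + m)) : Bool :=
  if h : i < m ∧ i ≤ l.val ∧ l.val - i < m then
    y (Sum.inl (Sum.inl ⟨i, h.1⟩)) && y (Sum.inl (Sum.inr ⟨l.val - i, h.2.2⟩))
  else false

/-- The addend costs one gate per bit. [cite: Vollmer1999, §1.3.2] -/
theorem cktSize_maskFn (m i : ℕ) : CktSize B2 (maskFn m i) ((m + m) * 1) := by
  have h : CktSize B2 (fun (y : MulWires m → Bool) (l : Fin (m + m)) => maskFn m i y l) (Fintype.card (Fin (m + m)) * 1) := by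
    refine CktSize.pi_const fun l => ?_
    unfold maskFn
    split
    · exact cktSize_and _ _
    · exact cktSize_const _ false
  simpa using h

/-- The value of the addend: `a_i · B · 2^i`. [cite: Vollmer1999, §1.3.2] -/
theorem ofBits_maskFn (m i : ℕ) (hi : i < m) (x : Fin m ⊕ Fin m → Bool) (acc : Fin (m + m) → Bool) :
    Nat.ofBits (maskFn m i (Sum.elim x acc)) =
      (x (Sum.inl ⟨i, hi⟩)).toNat * (Nat.ofBits (fun j => x (Sum.inr j)) * 2 ^ i) := by
  apply Nat.eq_of_testBit_eq
  intro j
  rw [Nat.testBit_ofBits]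
  cases ha : x (Sum.inl ⟨i, hi⟩)
  · -- `a_i = 0`: everything vanishes
    simp only [Bool.toNat_false, zero_mul, Nat.zero_testBit]
    split
    · simp [maskFn, ha, hi]
    · rfl
  · simp only [Bool.toNat_true, one_mul, Nat.testBit_mul_two_pow, Nat.testBit_ofBits]
    by_cases hj : j < m + m
    · rw [dif_pos hj]
      simp only [maskFn, Sum.elim_inl, hi, true_and, ha, Bool.true_and]
      by_cases hij : i ≤ j
      · by_cases hjm : j - i < m
        · rw [dif_pos ⟨hij, hjm⟩, decide_eq_true hij, Bool.true_and, dif_pos hjm]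
        · rw [dif_neg (fun h => hjm h.2), dif_neg hjm, Bool.and_false]
      · rw [dif_neg (fun h => hij h.1), decide_eq_false hij, Bool.false_and]
    · rw [dif_neg hj]
      have hjm : ¬ j - i < m := by omega
      rw [dif_neg hjm, Bool.and_false]

/-- The wires fed to the width-`2m` adder in a round: the accumulator and the addend. [folklore] -/
def adderEmb (m : ℕ) : Fin (m + m) ⊕ Fin (m + m) → MulWires m ⊕ Fin (m + m) :=
  Sum.elim (fun l => Sum.inl (Sum.inr l)) (fun l => Sum.inr l)

/-- One shift-and-add round as a map on the wires: keep the inputs, replace the accumulator by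
the low `2m` bits of `acc + addend`. [cite: Vollmer1999, §1.3.2] -/
def mulStep (m i : ℕ) (y : MulWires m → Bool) : MulWires m → Bool :=
  Sum.elim (fun j => y (Sum.inl j))
    (fun l => addBits (m + m) (Sum.elim (fun l' => y (Sum.inr l')) (maskFn m i y)) l.castSucc)

/-- Gate budget of one round. [cite: Vollmer1999, §1.3.2] -/
def mulStepSize (m : ℕ) : ℕ := (m + m) + addSize (m + m)

/-- One round costs `mulStepSize m = 74 · 2m + 1` gates. [cite: Vollmer1999, §1.3.2] -/
theorem cktSize_mulStep (m i : ℕ) : CktSize B2 (mulStep m i) (mulStepSize m) := by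
  have ha : CktSize B2 (fun y : MulWires m → Bool => Sum.elim y (maskFn m i y)) (0 + (m + m) * 1) :=
    (CktSize.id B2).pair (cktSize_maskFn m i)
  have hb : CktSize B2 (fun z : MulWires m ⊕ Fin (m + m) → Bool =>
      Sum.elim (fun j : Fin m ⊕ Fin m => z (Sum.inl (Sum.inl j)))
        (fun l : Fin (m + m) => addBits (m + m) (fun w => z (adderEmb m w)) l.castSucc)) (0 + addSize (m + m)) :=
    (CktSize.proj B2 (fun j : Fin m ⊕ Fin m => (Sum.inl (Sum.inl j) : MulWires m ⊕ Fin (m + m)))).pair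
      (((cktSize_addBits (m + m)).rewire (adderEmb m)).outMap Fin.castSucc)
  refine ((ha.comp hb).of_le (by simp [mulStepSize])).congr fun y w => ?_
  rcases w with j | l
  · rfl
  · simp only [mulStep, Sum.elim_inr]
    congr 1
    funext w
    rcases w with l' | l' <;> rfl

/-- **The shift-and-add invariant**: after `i ≤ m` rounds the wires carry the inputs and the bits
of `(A mod 2^i) · B`, at a cost of `i · mulStepSize m + 1` gates. [cite: Vollmer1999, §1.3.2] -/
theorem cktSize_accBits (m : ℕ) : ∀ i : ℕ, i ≤ m →
    CktSize B2 (fun x : Fin m ⊕ Fin m → Bool => Sum.elim x (accBits m i x)) (i * mulStepSize m + 1)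
  | 0, _ => by
    have h : CktSize B2 (fun x : Fin m ⊕ Fin m → Bool => Sum.elim x (fun (_ : Fin (m + m)) => false)) (0 + 1) :=
      (CktSize.id B2).pair ((cktSize_const (Fin m ⊕ Fin m) false).outMap fun _ => ())
    refine (h.of_le (by omega)).congr fun x w => ?_
    rcases w with j | l
    · rfl
    · simp [accBits, bitsOf, accVal, Nat.mod_one]
  | i + 1, hi => by
    have hi' : i < m := hi
    have h := (cktSize_accBits m i hi'.le).comp (cktSize_mulStep m i)
    refine (h.of_le (by rw [Nat.succ_mul]; omega)).congr fun x w => ?_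
    rcases w with j | l
    · rfl
    · -- the new accumulator bit `l`
      simp only [mulStep, Sum.elim_inl, Sum.elim_inr]
      -- both sides are bit `l` of a number; compare the numbers
      show (addVal (m + m) (Sum.elim (fun l' => accBits m i x l') (maskFn m i (Sum.elim x (accBits m i x))))).testBit l =
        (accVal m (i + 1) x).testBit l
      congr 1
      rw [addVal]
      change Nat.ofBits (accBits m i x) + Nat.ofBits (maskFn m i (Sum.elim x (accBits m i x))) = accVal m (i + 1) x
      rw [ofBits_accBits, ofBits_maskFn m i hi', accVal, accVal, Nat.mod_pow_succ, ← Nat.toNat_testBit,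
        Nat.testBit_ofBits_lt _ _ hi']
      ring

/-- **The schoolbook multiplier** (Vollmer 1999, §1.3.2): the `2m` bits of the product of two
`m`-bit numbers by a `B₂`-circuit with at most `m · mulStepSize m + 1` gates. The inputs are kept
among the outputs (convenient for further composition). [cite: Vollmer1999, §1.3.2] -/
theorem cktSize_mulBits_withInputs (m : ℕ) :
    CktSize B2 (fun x : Fin m ⊕ Fin m → Bool => Sum.elim x (mulBits m x)) (m * mulStepSize m + 1) := by
  refine (cktSize_accBits m m le_rfl).congr fun x w => ?_
  rcases w with j | l
  · rfl
  · simp only [Sum.elim_inr, accBits, mulBits, bitsOf, accVal, mulVal]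
    rw [Nat.mod_eq_of_lt (Nat.ofBits_lt_two_pow _)]

/-- **The schoolbook multiplier**, product bits only. [cite: Vollmer1999, §1.3.2] -/
theorem cktSize_mulBits (m : ℕ) : CktSize B2 (mulBits m) (m * mulStepSize m + 1) :=
  ((cktSize_mulBits_withInputs m).outMap Sum.inr).congr fun _ _ => rfl

end ArithCkt

end Literature.Computability.Complexity
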